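import Mathlib.LinearAlgebra.Matrix.Rank
import Mathlib.LinearAlgebra.Matrix.ToLin
import Mathlib.LinearAlgebra.FiniteDimensional.Lemmas
import Literature.NumberTheory.Transcendental.SixExponentialsSeveralVariablesSteps
import Literature.NumberTheory.Transcendental.SixExponentialsSeveralVariablesLattice
import HarnessLib

/-!
# Waldschmidt 1981, §§5–6: the extremal subspace (Lemme 5.1) and its coordinates

Topic `Literature/NumberTheory/Transcendental`; sibling proof file of
`SixExponentialsSeveralVariablesSteps.lean`, whose coefficient `μ(Γ, V)` (`Waldschmidt1981.mu`,
[Waldschmidt1981] §5 a)) it studies. Everything here is PROVED.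

* `exists_slope_maximal`, `exists_extremal_subspace` — the extremal subspace of **Lemme 5.1**
  ("Soit `Γ` un sous-groupe de type fini de `V`, de rang `ℓ`. On suppose `μ(Γ) < ℓ/n`. Alors il
  existe un sous-espace `W` de `V`, de dimension `n' > 0`, et un sous-groupe `Γ'` de `Γ ∩ W`, de
  rang `l'`, tels que `μ(Γ', W) = ℓ'/n' > ℓ/n`", p. 106, cited there from [7] Lemme 1.3.1),
  obtained as a subspace `W ≠ 0` maximising the slope `rang_ℤ(Γ ∩ W)/dim W`, with `Γ' = Γ ∩ W`:
  slope maximality is exactly `μ(Γ ∩ W, W) = rang(Γ ∩ W)/dim W`, and `μ(Γ) < ℓ/n` gives a slope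
  `> ℓ/n`. (The tree keeps the printed Lemme 5.1 as the named fact `Waldschmidt1981.lem_5_1`; the
  proofs of §6 use the present sharper form, which also yields "facteur direct" for free.)
* `span_inf_eq_of_slope_maximal` — the extremal `W` is spanned by `Γ ∩ W` (`n₁ = dim span X₁`).
* `not_mu_map_lt_of_slope_maximal` — in coordinates `P : W ≅ K^{n₁}`, the image of `Γ ∩ W` has
  `μ ≥ rang(Γ ∩ W)/n₁` (the form in which "`μ(X₁) = d₁/n₁`" enters Proposition 6.1, p. 110).
* `mulVecLin_surjective_of_linearIndependent`, `finrank_ker_mulVecLin_of_linearIndependent`,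
  `dotProduct_eq_zero_of_mem_ker` — the surjection `s : ℂⁿ → ℂⁿ/V ≅ W`, `z ↦ (⟨wₖ, z⟩)ₖ` for a
  basis `(wₖ)` of `W`, its kernel `V = W^⊥` of dimension `n − n₁` (p. 110: "On note `V`
  l'orthogonal de `W` … On identifie `ℂⁿ/V` à `W`").

## References

* [Waldschmidt1981] M. Waldschmidt, *Transcendance et exponentielles en plusieurs variables*,
  Invent. Math. 63 (1981) 97–127, §5 a) Lemme 5.1 (p. 106), §6 a) (pp. 109–110).
-/

noncomputable section

open Matrix Module

namespace Literature.NumberTheory.Transcendental.Waldschmidt1981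

/-! ### The extremal (slope-maximal) subspace — the content of Lemme 5.1 -/

section Extremal

variable {K : Type*} [Field K] {E : Type*} [AddCommGroup E] [Module K E]

/-- `rang_ℤ (X ∩ 0) = 0`. [folklore] -/
theorem rankInter_bot (X : Submodule ℤ E) : rankInter K X (⊥ : Submodule K E) = 0 := by
  have hbot : ((⊥ : Submodule K E).restrictScalars ℤ) = ⊥ := by ext v; simp
  rw [rankInter, hbot, inf_bot_eq, finrank_bot]

/-- Submodules of a finitely generated subgroup are finitely generated (`ℤ` is Noetherian).
[folklore] -/
theorem finite_inf_of_fg {X : Submodule ℤ E} (hX : X.FG) (p : Submodule ℤ E) :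
    Module.Finite ℤ ↥(X ⊓ p) := by
  haveI : Module.Finite ℤ X := Module.Finite.iff_fg.mpr hX
  exact Module.Finite.of_injective (Submodule.inclusion (inf_le_left : X ⊓ p ≤ X))
    (Submodule.inclusion_injective _)

/-- Monotonicity of `rang_ℤ (X ∩ U)` in the subspace `U`, for finitely generated `X`.
[folklore] -/
theorem rankInter_mono {X : Submodule ℤ E} (hX : X.FG) {U U' : Submodule K E} (h : U ≤ U') :
    rankInter K X U ≤ rankInter K X U' := by
  haveI := finite_inf_of_fg hX (U'.restrictScalars ℤ)
  exact Submodule.finrank_mono (inf_le_inf_left X (Submodule.restrictScalars_mono ℤ h))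

/-- If `X₁ = X ∩ W` then `rang_ℤ (X ∩ U) = rang_ℤ (X₁ ∩ U)` for `U ≤ W`. [folklore] -/
theorem rankInter_inf_of_le (X : Submodule ℤ E) {U W : Submodule K E} (h : U ≤ W) :
    rankInter K X U = rankInter K (X ⊓ W.restrictScalars ℤ) U := by
  have hUW : U.restrictScalars ℤ = W.restrictScalars ℤ ⊓ U.restrictScalars ℤ :=
    (inf_eq_right.mpr (Submodule.restrictScalars_mono ℤ h)).symm
  unfold rankInter
  rw [inf_assoc, ← hUW]

variable [FiniteDimensional K E]

open scoped Classical in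
/-- **The slope-maximal subspace** (the extremal subspace behind Lemme 5.1 of the source,
"Voir [7] lemme 1.3.1"): for a finitely generated subgroup `X` of a non-zero finite-dimensional
`K`-vector space there is a non-zero subspace `W` maximising the slope
`rang_ℤ(X ∩ W) / dim W`, i.e. `rang_ℤ(X ∩ U) · dim W ≤ rang_ℤ(X ∩ W) · dim U` for every subspace
`U`. (A maximum over the finite set of realised pairs `(dim U, rang_ℤ(X ∩ U))`.)
[cite: Waldschmidt1981, §5 a) Lemme 5.1 (p. 106)] -/
theorem exists_slope_maximal (X : Submodule ℤ E) (hX : X.FG) (hE : 0 < Module.finrank K E) :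
    ∃ W : Submodule K E, 0 < Module.finrank K W ∧
      ∀ U : Submodule K E,
        rankInter K X U * Module.finrank K W ≤ rankInter K X W * Module.finrank K U := by
  -- the finite set of realised pairs `(dim U, rank (X ∩ U))` with `dim U ≥ 1`
  set S : Finset (ℕ × ℕ) :=
    ((Finset.range (Module.finrank K E + 1)) ×ˢ (Finset.range (Module.finrank ℤ X + 1))).filter
      fun p => 0 < p.1 ∧ ∃ U : Submodule K E, Module.finrank K U = p.1 ∧ rankInter K X U = p.2
    with hS
  have hmemS : ∀ U : Submodule K E, 0 < Module.finrank K U →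
      (Module.finrank K U, rankInter K X U) ∈ S := by
    intro U hU
    simp only [hS, Finset.mem_filter, Finset.mem_product, Finset.mem_range, Nat.lt_succ_iff]
    exact ⟨⟨Submodule.finrank_le U, rankInter_le K hX U⟩, hU, U, rfl, rfl⟩
  have hne : S.Nonempty := ⟨_, hmemS ⊤ (by rwa [finrank_top])⟩
  obtain ⟨p₀, hp₀, hmax⟩ := Finset.exists_max_image S (fun p : ℕ × ℕ => (p.2 : ℚ) / p.1) hne
  have hp₀' := hp₀
  simp only [hS, Finset.mem_filter, Finset.mem_product, Finset.mem_range] at hp₀'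
  obtain ⟨-, hp₀pos, W, hW1, hW2⟩ := hp₀'
  refine ⟨W, hW1 ▸ hp₀pos, fun U => ?_⟩
  rcases Nat.eq_zero_or_pos (Module.finrank K U) with hU | hU
  · -- `U = ⊥`
    have hUbot : U = ⊥ := Submodule.finrank_eq_zero.mp hU
    subst hUbot
    rw [rankInter_bot, zero_mul]
    exact Nat.zero_le _
  · have h := hmax _ (hmemS U hU)
    rw [hW1, hW2]
    have hp1 : (0 : ℚ) < p₀.1 := by exact_mod_cast hp₀pos
    have hU' : (0 : ℚ) < Module.finrank K U := by exact_mod_cast hU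
    rw [div_le_div_iff₀ hU' hp1] at h
    exact_mod_cast h

/-- **The extremal subspace of Lemme 5.1.** If `X` is a finitely generated subgroup of rank `ℓ` of
the `n`-dimensional space `E` (`n > 0`) with `μ(X) < ℓ/n`, the slope-maximal subspace `W`
(`dim W = n' > 0`) satisfies `rang_ℤ(X ∩ W)/n' > ℓ/n` — and the slope maximality is the
statement `μ(X ∩ W, W) = rang_ℤ(X ∩ W)/n'` of the source (every proper subspace `U` of `W` has
`(ℓ' − rang(X ∩ U))/(n' − dim U) ≥ ℓ'/n'`, equivalently slope `≤ ℓ'/n'`).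
[cite: Waldschmidt1981, §5 a) Lemme 5.1 (p. 106) and §6 a) (pp. 109–110)] -/
theorem exists_extremal_subspace (X : Submodule ℤ E) (hX : X.FG) (hE : 0 < Module.finrank K E)
    (hmu : mu K X < (Module.finrank ℤ X : ℚ) / Module.finrank K E) :
    ∃ W : Submodule K E, 0 < Module.finrank K W ∧
      Module.finrank ℤ X * Module.finrank K W < rankInter K X W * Module.finrank K E ∧
      ∀ U : Submodule K E,
        rankInter K X U * Module.finrank K W ≤ rankInter K X W * Module.finrank K U := by
  obtain ⟨W, hW, hmax⟩ := exists_slope_maximal X hX hE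
  refine ⟨W, hW, ?_, hmax⟩
  -- a proper subspace `W₁` realising `μ(X)`
  obtain ⟨W₁, hW₁, hle₁, hmu₁⟩ := exists_mu_eq_dirichletQuot (K := K) (Γ := X) hE
  rw [hmu₁, dirichletQuot] at hmu
  set n := Module.finrank K E with hn
  set l := Module.finrank ℤ X with hl
  set ρ₁ := Module.finrank K W₁ with hρ₁
  set m₁ := rankInter K X W₁ with hm₁
  -- `ℓ ρ₁ < m₁ n`
  have h1 : l * ρ₁ < m₁ * n := by
    have hnρ : (0 : ℚ) < (n : ℚ) - ρ₁ := by
      have : (ρ₁ : ℚ) < n := by exact_mod_cast hW₁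
      linarith
    have hn' : (0 : ℚ) < n := by exact_mod_cast hE
    simp only at hmu
    rw [div_lt_div_iff₀ hnρ hn'] at hmu
    have : ((l : ℚ) - m₁) * n < l * (n - ρ₁) := hmu
    have h' : (l : ℚ) * ρ₁ < m₁ * n := by linarith
    exact_mod_cast h'
  -- hence `ρ₁ > 0`, and slope maximality `m₁ · dim W ≤ rank(X ∩ W) · ρ₁` gives the claim
  have hρ₁pos : 0 < ρ₁ := by
    rcases Nat.eq_zero_or_pos ρ₁ with h0 | h0
    · exfalso
      have hbot : W₁ = ⊥ := Submodule.finrank_eq_zero.mp (hρ₁ ▸ h0)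
      have : m₁ = 0 := by rw [hm₁, hbot, rankInter_bot]
      rw [h0, this] at h1
      simp at h1
    · exact h0
  have h2 := hmax W₁
  -- `l ρ₁ (dim W) < m₁ n (dim W) ≤ ... `
  have h3 : l * Module.finrank K W * ρ₁ < rankInter K X W * n * ρ₁ := by
    calc l * Module.finrank K W * ρ₁ = (l * ρ₁) * Module.finrank K W := by ring
      _ < (m₁ * n) * Module.finrank K W := Nat.mul_lt_mul_of_pos_right h1 hW
      _ = (m₁ * Module.finrank K W) * n := by ring
      _ ≤ (rankInter K X W * ρ₁) * n := Nat.mul_le_mul_right _ h2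
      _ = rankInter K X W * n * ρ₁ := by ring
  exact Nat.lt_of_mul_lt_mul_right h3

/-- The slope-maximal subspace is spanned by the part of `X` it contains
(`n₁ = dim span_K (X ∩ W)`): otherwise `span (X ∩ W)` would have a larger slope.
[cite: Waldschmidt1981, §6 a) (p. 110)] -/
theorem span_inf_eq_of_slope_maximal {X : Submodule ℤ E} (hX : X.FG) {W : Submodule K E}
    (hpos : 0 < rankInter K X W)
    (hmax : ∀ U : Submodule K E,
      rankInter K X U * Module.finrank K W ≤ rankInter K X W * Module.finrank K U) :
    Submodule.span K ((X ⊓ W.restrictScalars ℤ : Submodule ℤ E) : Set E) = W := by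
  set U := Submodule.span K ((X ⊓ W.restrictScalars ℤ : Submodule ℤ E) : Set E) with hU
  have hUW : U ≤ W := by
    rw [hU, Submodule.span_le]
    rintro z ⟨-, hz⟩
    exact hz
  have hXU : rankInter K X W ≤ rankInter K X U := by
    haveI := finite_inf_of_fg hX (U.restrictScalars ℤ)
    refine Submodule.finrank_mono (le_inf inf_le_left ?_)
    intro z hz
    exact Submodule.subset_span hz
  have h := hmax U
  have hdim : Module.finrank K W ≤ Module.finrank K U := by
    have : rankInter K X W * Module.finrank K W ≤ rankInter K X W * Module.finrank K U :=
      le_trans (Nat.mul_le_mul_right _ hXU) h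
    exact Nat.le_of_mul_le_mul_left this hpos
  exact Submodule.eq_of_le_of_finrank_le hUW hdim

end Extremal

/-! ### Transport to coordinates `K^{n₁}` of the extremal subspace -/

section Coord

variable {K : Type*} [Field K] {E : Type*} [AddCommGroup E] [Module K E]

/-- A `ℤ`-submodule of `W` keeps its rank under a `K`-linear map injective on `W`. [folklore] -/
theorem finrank_map_eq_of_injOn {n₁ : ℕ} {W : Submodule K E} (P : E →ₗ[K] (Fin n₁ → K))
    (hPinj : ∀ u ∈ W, P u = 0 → u = 0) (Z : Submodule ℤ E) (hZ : Z ≤ W.restrictScalars ℤ) :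
    Module.finrank ℤ ↥(Z.map (P.restrictScalars ℤ)) = Module.finrank ℤ Z := by
  have hinj : Function.Injective ((P.restrictScalars ℤ).domRestrict Z) := by
    intro a b hab
    apply Subtype.ext
    have h : P ((a : E) - b) = 0 := by
      have : P a = P b := hab
      rw [map_sub, this, sub_self]
    have := hPinj _ (hZ (Z.sub_mem a.2 b.2)) h
    exact sub_eq_zero.mp this
  have e := LinearEquiv.ofInjective _ hinj
  rw [LinearMap.range_domRestrict] at e
  exact (LinearEquiv.finrank_eq e).symm

/-- A subspace of `W` keeps its dimension under a `K`-linear map injective on `W`. [folklore] -/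
theorem finrank_map_eq_of_injOn' {n₁ : ℕ} {W : Submodule K E} (P : E →ₗ[K] (Fin n₁ → K))
    (hPinj : ∀ u ∈ W, P u = 0 → u = 0) (U : Submodule K E) (hU : U ≤ W) :
    Module.finrank K ↥(U.map P) = Module.finrank K U := by
  have hinj : Function.Injective (P.domRestrict U) := by
    intro a b hab
    apply Subtype.ext
    have h : P ((a : E) - b) = 0 := by
      have : P a = P b := hab
      rw [map_sub, this, sub_self]
    exact sub_eq_zero.mp (hPinj _ (hU (U.sub_mem a.2 b.2)) h)
  have e := LinearEquiv.ofInjective _ hinj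
  rw [LinearMap.range_domRestrict] at e
  exact (LinearEquiv.finrank_eq e).symm

/-- **Transport to coordinates.** Let `W` be slope-maximal for the finitely generated subgroup
`X` of `E`, `dim W = n₁ > 0`, `X₁ = X ∩ W` of rank `d₁`, and let `P : E → K^{n₁}` be `K`-linear,
injective on `W` and mapping `W` onto `K^{n₁}` (coordinates). Then the image `X₁'' = P(X₁)`
satisfies `μ(X₁'', K^{n₁}) ≥ d₁/n₁`: a proper subspace `U''` of `K^{n₁}` with
`(d₁ − rang(X₁'' ∩ U''))/(n₁ − dim U'') < d₁/n₁` would pull back to a subspace `U ≤ W` of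
slope `> d₁/n₁`. (This is "`μ(X₁) = d₁/n₁`" of the source, read in the coordinates in which
Proposition 6.1 is applied.) [cite: Waldschmidt1981, §6 a) (p. 110)] -/
theorem not_mu_map_lt_of_slope_maximal {X : Submodule ℤ E} {W : Submodule K E}
    {n₁ : ℕ} (hn₁ : Module.finrank K W = n₁) (h0 : 0 < n₁)
    (hmax : ∀ U : Submodule K E,
      rankInter K X U * Module.finrank K W ≤ rankInter K X W * Module.finrank K U)
    (P : E →ₗ[K] (Fin n₁ → K)) (hPinj : ∀ u ∈ W, P u = 0 → u = 0)
    (hPsurj : ∀ z, ∃ u ∈ W, P u = z) :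
    ¬ mu K ((X ⊓ W.restrictScalars ℤ).map (P.restrictScalars ℤ)) <
        (rankInter K X W : ℚ) / n₁ := by
  set X₁ : Submodule ℤ E := X ⊓ W.restrictScalars ℤ with hX₁
  set X₁'' : Submodule ℤ (Fin n₁ → K) := X₁.map (P.restrictScalars ℤ) with hX₁''
  have hd₁ : Module.finrank ℤ X₁'' = rankInter K X W :=
    finrank_map_eq_of_injOn P hPinj X₁ inf_le_right
  intro hlt
  have hnK : 0 < Module.finrank K (Fin n₁ → K) := by rwa [Module.finrank_fin_fun]
  obtain ⟨U'', hU''lt, hle'', hmu''⟩ :=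
    exists_mu_eq_dirichletQuot (K := K) (Γ := X₁'') hnK
  rw [Module.finrank_fin_fun] at hU''lt
  -- pull back `U''`
  set U : Submodule K E := U''.comap P ⊓ W with hU
  have hUW : U ≤ W := inf_le_right
  have hmapU : U.map P = U'' := by
    apply le_antisymm
    · rintro _ ⟨u, hu, rfl⟩
      exact hu.1
    · intro z hz
      obtain ⟨u, huW, rfl⟩ := hPsurj z
      exact ⟨u, ⟨hz, huW⟩, rfl⟩
  have hρ : Module.finrank K U = Module.finrank K U'' := by
    rw [← hmapU, finrank_map_eq_of_injOn' P hPinj U hUW]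
  have hmapXU : (X ⊓ U.restrictScalars ℤ).map (P.restrictScalars ℤ) =
      X₁'' ⊓ U''.restrictScalars ℤ := by
    apply le_antisymm
    · rintro _ ⟨z, ⟨hzX, hzU⟩, rfl⟩
      have hzU' : z ∈ U := hzU
      refine ⟨⟨z, ⟨hzX, hUW hzU'⟩, rfl⟩, ?_⟩
      exact hzU'.1
    · rintro w ⟨⟨z₁, hz₁, rfl⟩, hwU⟩
      have hz₁W : z₁ ∈ W := hz₁.2
      have hz₁U : z₁ ∈ U := ⟨hwU, hz₁W⟩
      exact ⟨z₁, ⟨hz₁.1, hz₁U⟩, rfl⟩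
  have hlam : rankInter K X U = rankInter K X₁'' U'' := by
    unfold rankInter
    rw [← hmapXU, finrank_map_eq_of_injOn P hPinj _
      (le_trans inf_le_right (Submodule.restrictScalars_mono ℤ hUW))]
  -- the numerics
  set d₁ := rankInter K X W with hd₁def
  set ρ := Module.finrank K U'' with hρdef
  set m := rankInter K X₁'' U'' with hmdef
  have hmax' := hmax U
  rw [hρ, hlam, hn₁] at hmax'
  -- `hmax' : m * n₁ ≤ d₁ * ρ`; from `hlt`: `d₁ ρ < m n₁`
  rw [hmu'', dirichletQuot, hd₁, Module.finrank_fin_fun] at hlt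
  have hnρ : (0 : ℚ) < (n₁ : ℚ) - ρ := by
    have : (ρ : ℚ) < n₁ := by exact_mod_cast hU''lt
    linarith
  have hn' : (0 : ℚ) < n₁ := by exact_mod_cast h0
  simp only at hlt
  rw [div_lt_div_iff₀ hnρ hn'] at hlt
  have h2 : (d₁ : ℚ) * ρ < m * n₁ := by linarith
  have h3 : d₁ * ρ < m * n₁ := by exact_mod_cast h2
  omega

end Coord

/-! ### The dual map `T v = (wₖ ⬝ᵥ v)ₖ` of a linearly independent family -/

section Dual

variable {K : Type*} [Field K] {n n₁ : ℕ}

/-- For a `K`-linearly independent family `w₁, …, w_{n₁}` of `Kⁿ` (the rows of a matrix `w`),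
the map `v ↦ (⟨wₖ, v⟩)ₖ = w v : Kⁿ → K^{n₁}` is surjective (the matrix has rank `n₁`).
[cite: Waldschmidt1981, §6 a) (p. 110: "On identifie `ℂⁿ/V` à `W`")] -/
theorem mulVecLin_surjective_of_linearIndependent (w : Matrix (Fin n₁) (Fin n) K)
    (hw : LinearIndependent K w.row) : Function.Surjective w.mulVecLin := by
  rw [← LinearMap.range_eq_top]
  apply Submodule.eq_top_of_finrank_eq
  have h : w.rank = n₁ := by simpa using hw.rank_matrix
  rw [Module.finrank_fin_fun]
  exact h

/-- The kernel `V` of `v ↦ (⟨wₖ, v⟩)ₖ` has dimension `n − n₁`.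
[cite: Waldschmidt1981, §6 a) (p. 110)] -/
theorem finrank_ker_mulVecLin_of_linearIndependent (w : Matrix (Fin n₁) (Fin n) K)
    (hw : LinearIndependent K w.row) :
    Module.finrank K (LinearMap.ker w.mulVecLin) + n₁ = n := by
  have h1 := LinearMap.finrank_range_add_finrank_ker w.mulVecLin
  have h2 : Module.finrank K (LinearMap.range w.mulVecLin) = n₁ := by
    rw [LinearMap.range_eq_top.mpr (mulVecLin_surjective_of_linearIndependent w hw)]
    simp
  rw [h2, Module.finrank_fin_fun] at h1
  omega

/-- Elements of the kernel of `v ↦ (⟨wₖ, v⟩)ₖ` are orthogonal to the span of the rows `wₖ`.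
[cite: Waldschmidt1981, §6 a) (p. 110: "`V` l'orthogonal de `W`")] -/
theorem dotProduct_eq_zero_of_mem_ker (w : Matrix (Fin n₁) (Fin n) K) {v : Fin n → K}
    (hv : v ∈ LinearMap.ker w.mulVecLin) {u : Fin n → K}
    (hu : u ∈ Submodule.span K (Set.range w.row)) : u ⬝ᵥ v = 0 := by
  rw [LinearMap.mem_ker, Matrix.mulVecLin_apply] at hv
  induction hu using Submodule.span_induction with
  | mem z hz =>
    obtain ⟨k, rfl⟩ := hz
    have := congrFun hv k
    simpa [Matrix.mulVec, Matrix.row] using this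
  | zero => simp
  | add a b _ _ ha hb => rw [add_dotProduct, ha, hb, add_zero]
  | smul c a _ ha => rw [smul_dotProduct, ha, smul_zero]

end Dual

/-- The span of a basis of a submodule, coerced to the ambient module, is the submodule.
[folklore] -/
theorem span_range_coe_basis {R M : Type*} [Ring R] [AddCommGroup M] [Module R M]
    {ι : Type*} {N : Submodule R M} (b : Basis ι R N) :
    Submodule.span R (Set.range fun i => (b i : M)) = N := by
  have h : (Set.range fun i => (b i : M)) = N.subtype '' Set.range b := by
    ext z; simp [Set.mem_image, Set.mem_range]
  rw [h, Submodule.span_image, b.span_eq, Submodule.map_top, Submodule.range_subtype]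

end Literature.NumberTheory.Transcendental.Waldschmidt1981

end
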